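import Summits.BirchSwinnertonDyer.Rank1Residual.Additive.KatoDescentKatoRigidDictionary
import Summits.BirchSwinnertonDyer.Rank1Residual.Additive.KatoDescentKatoRigidTwistLimit
import Summits.BirchSwinnertonDyer.Rank1Residual.Additive.KatoDescentKatoRigidPoints
import Summits.BirchSwinnertonDyer.Rank1Residual.Additive.KatoDescentKatoRigidLayerGenerator
import Summits.BirchSwinnertonDyer.Rank1Residual.Additive.KatoDescentKatoRigidAnalyticBridge
import HarnessLib

set_option autoImplicit false

/-!
# AUG engine, step 17: the POINT VALUES — at the character point of a faithful character of `Γ_k`, read at a level `n ≥ k`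
# whose twist exponent is `p^k`-close to the limit `β*`, the Iwasawa functions `e·p^{v₂}FΦ₁` and `p^{v₁}GΦ₂(1+T)^{β*}` take
# the same value in `ℂ_p`
# (seat `bsd-cm-prr-ty1` g15, cell `bsd-cm`; theorems only: no definition, no named fact, no instance, no `sorry`)

Part 59 of the seat's kernel cut of stub 3 of the Kato–Perrin-Riou skeletons v4 (cruxes stmt-BirchSwinnertonDyer-19945 /
-19223).  THE PER-POINT STEP of the ENDGAME for the display AUG (HOME `bsd-cm-prr-ty1/STUB3-CUT.md` §6 addenda 7–8), assembling
E35 (★χ), E44 (the explicit dictionary `Φ₁, Φ₂`), E43 (`χ̄(a) ↔ (1+T)^{κ(σ_a)}`), E45 (algebra + twist transfer), E42 (layer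
characters and their lifts), E41 (transport to `ℂ_p`) and E39 (analytic values):
★ `exists_point_hasSum_eq` — for AUG's data (two `ZetaBody` families with `Λ₂ = e • Λ₁`, Kato's guards, lifts `y₁, y₂` into one pin
with a collinearity `F • y₁ = G • y₂`), Iwasawa functions `Φᵢ` READING the numbers of (★χ) after clearing `p^{vᵢ}` (the output of
E44, taken as hypotheses), a layer character `χ₀` mod `p^{k+1}` lifted to the level `M = p^{n+1}`, `n ≥ k`, an entire continuation
`L₀` of its twisted series with `L₀(1) ≠ 0`, a frame rotation `ι₂ ∘ σ_a = ι₁` at level `M` realised by `σₐ ∈ Gal(ℚ̄/ℚ)`, an exponent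
`β*` with `p^k ∣ κ(σₐ) − β*`, and a `ℚ_p`-algebra map `ψ : ℚ_p ⊗ ℚ(ζ_M) → ℂ_p` through an embedding: THERE IS a point `z ∈ ℂ_p`,
`‖z‖ < 1`, `z + 1` a PRIMITIVE `p^k`-th root of unity, and a common value `w` of the evaluation series at `z` of
`C(e)·(p^{v₂}·F·Φ₁)` and of `p^{v₁}·G·Φ₂·(1+T)^{β*}` (both in `Λ ⊗ ℚ_p`).
HONEST LABEL: a theorem about the tree's readings; no stub closed; nothing asserted on 19945 / 19223; Kato's Thm 12.4 is not used
here; no summit statement is proved; BSD is not proved for any curve.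
References: [Kato2004Asterisque] §13.9 (p. 230), Thm. 6.6 (1) (p. 163), Thm. 9.7 (p. 189); [Washington1997] §7.1–§7.2, §13.1–§13.2;
[MazurTateTeitelbaum1986Invent] §I.13.
-/

noncomputable section

open scoped BigOperators NumberField TensorProduct
open Polynomial Field IsDedekindDomain CongruenceSubgroup
open Literature.NumberTheory.GaloisRepresentations
open Literature.NumberTheory.EllipticCurves Literature.NumberTheory.EllipticCurves.ModularForms
open Literature.NumberTheory.EllipticCurves.Kato2004 Literature.NumberTheory.EllipticCurves.Kato2004.EulerSystemValues
open Rat.HeightOneSpectrum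

namespace Summit.BirchSwinnertonDyer.Rank1Residual.Additive.PerrinRiouUnit

variable {W : WeierstrassCurve ℚ} [W.IsElliptic] {p : ℕ} [hp : Fact p.Prime] [ContinuousSMul ℤ_[p] (W.tateModule p)]
  [Module.Free ℤ_[p] (W.tateModule p)] [Module.Finite ℤ_[p] (W.tateModule p)]
  {N : ℕ} [NeZero N] {f : CuspForm (Gamma0 N) 2} {ι₁ ι₂ : (m : ℕ) → (CyclotomicField m ℚ →+* ℂ)} {q₁ q₂ : ℚ}
  {Λ₁ Λ₂ : ∀ (k : ℕ) (r : Finset (HeightOneSpectrum (𝓞 ℚ))),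
    H1 (tateRep W p) (cycSubgroup p k r) →ₗ[ℤ_[p]] ℚ_[p] ⊗[ℚ] CyclotomicField (cycLevel p k r) ℚ}
  {c₁ d₁ a₁ : ℤ} {A₁ : ℕ} {d'₁ : ℤ} {c₂ d₂ a₂ : ℤ} {A₂ : ℕ} {d'₂ : ℤ}
  {z₁ : ∀ (k : ℕ) (r : (cyclotomicLevelsRat p (badPlaces c₁ d₁ A₁ N)).Ideals),
    H1 (tateRep W p) ((cyclotomicLevelsRat p (badPlaces c₁ d₁ A₁ N)).level k r.1)}
  {x₁ : ∀ (k : ℕ) (r : (cyclotomicLevelsRat p (badPlaces c₁ d₁ A₁ N)).Ideals), CyclotomicField (cycLevel p k r.1) ℚ}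
  {z₂ : ∀ (k : ℕ) (r : (cyclotomicLevelsRat p (badPlaces c₂ d₂ A₂ N)).Ideals),
    H1 (tateRep W p) ((cyclotomicLevelsRat p (badPlaces c₂ d₂ A₂ N)).level k r.1)}
  {x₂ : ∀ (k : ℕ) (r : (cyclotomicLevelsRat p (badPlaces c₂ d₂ A₂ N)).Ideals), CyclotomicField (cycLevel p k r.1) ℚ}
  {K : ZpExtension ℚ p} {γ : absoluteGaloisGroup ℚ}

set_option maxHeartbeats 3200000 in
/-- ★ **The point values.**  See the module docstring: from AUG's data, the readings `Φ₁, Φ₂` of E44 (hypotheses `hΦ₁`, `hΦ₂`),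
a layer character `χ₀` mod `p^{k+1}` lifted to `M = p^{n+1}` (`n ≥ k`) with a non-vanishing continuation, a realised frame
rotation `σₐ` and an exponent `β*` with `p^k ∣ κ(σₐ) − β*`, and `ψ : ℚ_p ⊗ ℚ(ζ_M) → ℂ_p` through an embedding: a point `z` of the
open unit disc of `ℂ_p` with `z + 1` a primitive `p^k`-th root of unity at which `C(e)·(p^{v₂}FΦ₁)` and `p^{v₁}GΦ₂(1+T)^{β*}` have a
common value. [cite: Kato2004Asterisque, §13.9 (p. 230), Thm. 6.6 (1) (p. 163), Thm. 9.7 (p. 189)] [cite: Washington1997, §7.2 and §13.2] -/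
theorem exists_point_hasSum_eq (hp2 : p ≠ 2) (hnf : IsNewformOf W f) {e : ℚ_[p]}
    (hΛ : ∀ (k : ℕ) (y : H1 (tateRep W p) (cycSubgroup p k ∅)), Λ₂ k ∅ y = e • Λ₁ k ∅ y)
    (hA₁ : 0 < A₁) (hc₁ : Int.gcd c₁ (6 * p * A₁) = 1) (hd₁ : Int.gcd d₁ (6 * p * N) = 1)
    (hdd₁ : (d₁ : ℤ) * d'₁ ≡ 1 [ZMOD (A₁ : ℤ)])
    (hA₂ : 0 < A₂) (hc₂ : Int.gcd c₂ (6 * p * A₂) = 1) (hd₂ : Int.gcd d₂ (6 * p * N) = 1)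
    (hdd₂ : (d₂ : ℤ) * d'₂ ≡ 1 [ZMOD (A₂ : ℤ)])
    (hb₁ : ZetaBody W p f ι₁ ((q₁ : ℚ) : ℝ) Λ₁ c₁ d₁ a₁ A₁ z₁ x₁) (hb₂ : ZetaBody W p f ι₂ ((q₂ : ℚ) : ℝ) Λ₂ c₂ d₂ a₂ A₂ z₂ x₂)
    (hK : K.IsCyclotomic) (hγ : K.IsTopGenerator γ) (I : IwasawaH1Data W p K γ) {y₁ y₂ : I.H}
    (hy₁ : ∀ n : ℕ, I.proj n y₁ = levelToLayer W p hK hp2 (badPlaces c₁ d₁ A₁ N) n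
      (z₁ (n + 1) (cyclotomicLevelsRat p (badPlaces c₁ d₁ A₁ N)).idealOne))
    (hy₂ : ∀ n : ℕ, I.proj n y₂ = levelToLayer W p hK hp2 (badPlaces c₂ d₂ A₂ N) n
      (z₂ (n + 1) (cyclotomicLevelsRat p (badPlaces c₂ d₂ A₂ N)).idealOne))
    {F G : IwasawaAlgebra p} (hFG : F • y₁ = G • y₂)
    -- the readings (output of E44)
    {v₁ v₂ : ℕ} {Φ₁ Φ₂ : PowerSeries ℤ_[p]}
    (hΦ₁ : ∀ (n : ℕ) {M : ℕ} [NeZero M] (_hM : M = p ^ (n + 1)) (χ : DirichletCharacter ℂ M)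
        (_hχ : ∀ τ ∈ K.layerSubgroup n, χ ((modNCyclotomicCharacter ℚ M τ : (ZMod M)ˣ) : ZMod M) = 1)
        (R : ℤ_[p][X]),
        Φ₁ - (R : PowerSeries ℤ_[p]) ∈
          Ideal.span {(((X + 1 : ℤ_[p][X]) ^ p ^ n - 1 : ℤ_[p][X]) : PowerSeries ℤ_[p])} →
        ((p : ℚ_[p]) ^ v₁) • ((1 : ℚ_[p]) ⊗ₜ[ℚ] ((((q₁ : ℚ) : ℝ) : ℂ) *
          (∏ ℓ ∈ (M * (p * A₁)).primeFactors.filter (fun ℓ => ¬ ℓ ∣ M),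
              (1 - χ (ℓ : ZMod M) * cuspCoeff f ℓ * (ℓ : ℂ) ^ (-(1 : ℂ)) +
                (if ℓ ∣ N then 0 else (ℓ : ℂ)) * χ (ℓ : ZMod M) ^ 2 * ((ℓ : ℂ) ^ (-(1 : ℂ))) ^ 2)) *
          cuspFactor f true (fun k ↦ χ⁻¹ (k : ZMod M)) c₁ d₁ a₁ A₁ d'₁) : ℚ_[p] ⊗[ℚ] ℂ) =
        aeval (((1 : ℚ_[p]) ⊗ₜ[ℚ] χ⁻¹ ((modNCyclotomicCharacter ℚ M γ : (ZMod M)ˣ) : ZMod M) : ℚ_[p] ⊗[ℚ] ℂ) - 1) R)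
    (hΦ₂ : ∀ (n : ℕ) {M : ℕ} [NeZero M] (_hM : M = p ^ (n + 1)) (χ : DirichletCharacter ℂ M)
        (_hχ : ∀ τ ∈ K.layerSubgroup n, χ ((modNCyclotomicCharacter ℚ M τ : (ZMod M)ˣ) : ZMod M) = 1)
        (R : ℤ_[p][X]),
        Φ₂ - (R : PowerSeries ℤ_[p]) ∈
          Ideal.span {(((X + 1 : ℤ_[p][X]) ^ p ^ n - 1 : ℤ_[p][X]) : PowerSeries ℤ_[p])} →
        ((p : ℚ_[p]) ^ v₂) • ((1 : ℚ_[p]) ⊗ₜ[ℚ] ((((q₂ : ℚ) : ℝ) : ℂ) *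
          (∏ ℓ ∈ (M * (p * A₂)).primeFactors.filter (fun ℓ => ¬ ℓ ∣ M),
              (1 - χ (ℓ : ZMod M) * cuspCoeff f ℓ * (ℓ : ℂ) ^ (-(1 : ℂ)) +
                (if ℓ ∣ N then 0 else (ℓ : ℂ)) * χ (ℓ : ZMod M) ^ 2 * ((ℓ : ℂ) ^ (-(1 : ℂ))) ^ 2)) *
          cuspFactor f true (fun k ↦ χ⁻¹ (k : ZMod M)) c₂ d₂ a₂ A₂ d'₂) : ℚ_[p] ⊗[ℚ] ℂ) =
        aeval (((1 : ℚ_[p]) ⊗ₜ[ℚ] χ⁻¹ ((modNCyclotomicCharacter ℚ M γ : (ZMod M)ˣ) : ZMod M) : ℚ_[p] ⊗[ℚ] ℂ) - 1) R)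
    -- the level, the faithful character and its lift, the continuation
    {k n : ℕ} (hkn : k ≤ n) {χ₀ : DirichletCharacter ℂ (p ^ (k + 1))}
    (hker : ∀ b : (ZMod (p ^ (k + 1)))ˣ, χ₀ b = 1 ↔ b ^ (p - 1) = 1)
    (hdvd : p ^ (k + 1) ∣ cycLevel p (n + 1) ∅)
    {L₀ : ℂ → ℂ} (hd : Differentiable ℂ L₀)
    (hs : ∀ s : ℂ, 2 < s.re → L₀ s = twistedLSeries f (DirichletCharacter.changeLevel hdvd χ₀) s) (hL : L₀ 1 ≠ 0)
    -- the realised frame rotation and the exponent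
    {a : (ZMod (cycLevel p (n + 1) ∅))ˣ}
    (ha : ∀ y, ι₂ (cycLevel p (n + 1) ∅) (sigma (cycLevel p (n + 1) ∅) a y) = ι₁ (cycLevel p (n + 1) ∅) y)
    {σₐ : absoluteGaloisGroup ℚ}
    (hσₐ : ((modNCyclotomicCharacter ℚ (cycLevel p (n + 1) ∅) σₐ : (ZMod (cycLevel p (n + 1) ∅))ˣ) :
      ZMod (cycLevel p (n + 1) ∅)) = (a : ZMod (cycLevel p (n + 1) ∅)))
    {β : ℤ_[p]} (hβ : (p : ℤ_[p]) ^ k ∣ β - (K σₐ).toAdd)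
    -- the target
    {ψ : ℚ_[p] ⊗[ℚ] CyclotomicField (cycLevel p (n + 1) ∅) ℚ →ₐ[ℚ_[p]] ℂ_[p]}
    {j : CyclotomicField (cycLevel p (n + 1) ∅) ℚ →+* ℂ_[p]}
    (hψ : ∀ x : CyclotomicField (cycLevel p (n + 1) ∅) ℚ, ψ ((1 : ℚ_[p]) ⊗ₜ[ℚ] x) = j x) :
    ∃ z : ℂ_[p], IsPrimitiveRoot (z + 1) (p ^ k) ∧ ‖z‖ < 1 ∧ ∃ w : ℂ_[p],
      HasSum (fun i ↦ algebraMap ℚ_[p] ℂ_[p] (PowerSeries.coeff i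
        (PowerSeries.C e * PowerSeries.map (algebraMap ℤ_[p] ℚ_[p])
          (PowerSeries.C ((p : ℤ_[p]) ^ v₂) * F * Φ₁))) * z ^ i) w ∧
      HasSum (fun i ↦ algebraMap ℚ_[p] ℂ_[p] (PowerSeries.coeff i
        (PowerSeries.map (algebraMap ℤ_[p] ℚ_[p])
          (PowerSeries.C ((p : ℤ_[p]) ^ v₁) * G * Φ₂ * PowerSeries.binomialSeries ℤ_[p] β))) * z ^ i) w := by
  -- the level `M = p^{n+1}`
  have hM : cycLevel p (n + 1) ∅ = p ^ (n + 1) := by simp [cycLevel]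
  haveI : NeZero (cycLevel p (n + 1) ∅) := ⟨by rw [hM]; exact pow_ne_zero _ hp.out.ne_zero⟩
  set χ : DirichletCharacter ℂ (cycLevel p (n + 1) ∅) := DirichletCharacter.changeLevel hdvd χ₀ with hχdef
  have hker' : ∀ b : (ZMod (p ^ (k + 1)))ˣ, b ^ (p - 1) = 1 → χ₀ b = 1 := fun b hb => (hker b).mpr hb
  have hχ : ∀ τ ∈ K.layerSubgroup n, χ ((modNCyclotomicCharacter ℚ (cycLevel p (n + 1) ∅) τ : (ZMod (cycLevel p (n + 1) ∅))ˣ) : ZMod (cycLevel p (n + 1) ∅)) = 1 := fun τ hτ =>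
    changeLevel_apply_modNCyclotomicCharacter_eq_one_of_mem_layerSubgroup hK hp2 hM hdvd hker' hτ
  have heven : χ (-1) = 1 := changeLevel_apply_neg_one hp2 hdvd hker'
  -- the χ-component functional and the representatives
  obtain ⟨ev, hev⟩ := exists_charSumTensor p (cycLevel p (n + 1) ∅) (ι₁ (cycLevel p (n + 1) ∅)) χ
  obtain ⟨rF, hrF⟩ := exists_rep (p := p) n F
  obtain ⟨rG, hrG⟩ := exists_rep (p := p) n G
  obtain ⟨R₁, hR₁⟩ := exists_rep (p := p) n Φ₁
  obtain ⟨R₂, hR₂⟩ := exists_rep (p := p) n Φ₂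
  obtain ⟨ra, hra⟩ := exists_rep (p := p) n (PowerSeries.binomialSeries ℤ_[p] (K σₐ).toAdd)
  -- (★χ)
  have hstar := aeval_mul_explicitValues_eq_of_augData hp2 hnf hΛ hA₁ hc₁ hd₁ hdd₁ hA₂ hc₂ hd₂ hdd₂ hb₁ hb₂ hK hγ I hy₁ hy₂
    hFG n hrF hrG χ hχ heven hev ha hd hs hL
  conv at hstar => rhs; rw [one_tmul_mul]
  -- the readings
  have h₁ := hΦ₁ n hM χ hχ R₁ hR₁
  have h₂ := hΦ₂ n hM χ hχ R₂ hR₂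
  have ha' := read_inv_apply hγ n χ hχ σₐ hσₐ ra hra
  have key := smul_aeval_eq_aeval_of_reads hstar h₁ h₂ ha'
  -- the point: `u = 1 ⊗ ζ_χ`, `ζ_χ = χ₀⁻¹(χ_cyc γ)` a primitive `p^k`-th root of unity, its preimage `ζ'` in `ℚ(ζ_M)`
  have hζχ : χ⁻¹ ((modNCyclotomicCharacter ℚ (cycLevel p (n + 1) ∅) γ : (ZMod (cycLevel p (n + 1) ∅))ˣ) : ZMod (cycLevel p (n + 1) ∅)) =
      χ₀⁻¹ ((modNCyclotomicCharacter ℚ (p ^ (k + 1)) γ : (ZMod (p ^ (k + 1)))ˣ) : ZMod (p ^ (k + 1))) := by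
    rw [hχdef, changeLevel_inv, changeLevel_apply_modNCyclotomicCharacter hkn hM hdvd]
  haveI : NeZero (p ^ (k + 1)) := ⟨pow_ne_zero _ hp.out.ne_zero⟩
  have hprim : IsPrimitiveRoot (χ⁻¹ ((modNCyclotomicCharacter ℚ (cycLevel p (n + 1) ∅) γ : (ZMod (cycLevel p (n + 1) ∅))ˣ) : ZMod (cycLevel p (n + 1) ∅))) (p ^ k) := by
    rw [hζχ]
    exact isPrimitiveRoot_inv_apply_modNCyclotomicCharacter hK hp2 hγ k rfl hker
  have hpowM : (χ⁻¹ ((modNCyclotomicCharacter ℚ (cycLevel p (n + 1) ∅) γ : (ZMod (cycLevel p (n + 1) ∅))ˣ) : ZMod (cycLevel p (n + 1) ∅))) ^ cycLevel p (n + 1) ∅ = 1 := by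
    have h : (χ⁻¹ ((modNCyclotomicCharacter ℚ (cycLevel p (n + 1) ∅) γ : (ZMod (cycLevel p (n + 1) ∅))ˣ) :
        ZMod (cycLevel p (n + 1) ∅))) ^ p ^ (n + 1) = 1 :=
      (hprim.pow_eq_one_iff_dvd _).mpr (pow_dvd_pow p (by omega))
    rwa [← hM] at h
  obtain ⟨ζ', hζ', -⟩ := exists_apply_eq_of_pow_eq_one (ι₁ (cycLevel p (n + 1) ∅)) hpowM
  have hζ'prim : IsPrimitiveRoot ζ' (p ^ k) := isPrimitiveRoot_of_apply_eq (ι₁ (cycLevel p (n + 1) ∅)) hprim hζ'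
  -- transport to `ℂ_p`
  rw [← hζ', ← coe_toRatAlgHom_ringHom (ι₁ (cycLevel p (n + 1) ∅)) ζ'] at key
  have hC := eval₂_eq_of_smul_aeval_eq_map ((ι₁ (cycLevel p (n + 1) ∅)).toRatAlgHom) (ι₁ (cycLevel p (n + 1) ∅)).injective ψ key
  obtain ⟨hz1, hz2⟩ := isPrimitiveRoot_and_norm_lt_of_eq_ringHom hψ hζ'prim
  refine ⟨ψ ((1 : ℚ_[p]) ⊗ₜ[ℚ] ζ') - 1, hz1, hz2, (Polynomial.C ((p : ℤ_[p]) ^ v₁) * rG * R₂ * ra).eval₂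
    ((algebraMap ℚ_[p] ℂ_[p]).comp (algebraMap ℤ_[p] ℚ_[p])) (ψ ((1 : ℚ_[p]) ⊗ₜ[ℚ] ζ') - 1), ?_, ?_⟩
  · -- `C(e)·(p^{v₂} F Φ₁)` at `z`: representative `p^{v₂} r_F R₁` modulo `ω_k`
    have hrep : PowerSeries.C ((p : ℤ_[p]) ^ v₂) * F * Φ₁ -
        ((Polynomial.C ((p : ℤ_[p]) ^ v₂) * rF * R₁ : ℤ_[p][X]) : PowerSeries ℤ_[p]) ∈
          Ideal.span {(((X + 1 : ℤ_[p][X]) ^ p ^ k - 1 : ℤ_[p][X]) : PowerSeries ℤ_[p])} :=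
      rep_of_le hkn (rep_mul n (rep_mul n (rep_C n _) hrF) hR₁)
    have hsum := hasSum_coeff_of_sub_coe_mem_span hrep hz2 hz1.pow_eq_one
    have hfun : (fun i ↦ algebraMap ℚ_[p] ℂ_[p] (PowerSeries.coeff i
        (PowerSeries.C e * PowerSeries.map (algebraMap ℤ_[p] ℚ_[p]) (PowerSeries.C ((p : ℤ_[p]) ^ v₂) * F * Φ₁))) *
          (ψ ((1 : ℚ_[p]) ⊗ₜ[ℚ] ζ') - 1) ^ i) =
        fun i ↦ algebraMap ℚ_[p] ℂ_[p] e * (((algebraMap ℚ_[p] ℂ_[p]).comp (algebraMap ℤ_[p] ℚ_[p]))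
          (PowerSeries.coeff i (PowerSeries.C ((p : ℤ_[p]) ^ v₂) * F * Φ₁)) * (ψ ((1 : ℚ_[p]) ⊗ₜ[ℚ] ζ') - 1) ^ i) := by
      funext i
      rw [PowerSeries.coeff_C_mul, PowerSeries.coeff_map, map_mul, RingHom.comp_apply, mul_assoc]
    rw [hfun, ← hC]
    exact hsum.mul_left _
  · -- `p^{v₁} G Φ₂ (1+T)^{β*}` at `z`: representative `p^{v₁} r_G R₂ r_a` modulo `ω_k` (twist transfer)
    have hrep : PowerSeries.C ((p : ℤ_[p]) ^ v₁) * G * Φ₂ * PowerSeries.binomialSeries ℤ_[p] β -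
        ((Polynomial.C ((p : ℤ_[p]) ^ v₁) * rG * R₂ * ra : ℤ_[p][X]) : PowerSeries ℤ_[p]) ∈
          Ideal.span {(((X + 1 : ℤ_[p][X]) ^ p ^ k - 1 : ℤ_[p][X]) : PowerSeries ℤ_[p])} :=
      rep_mul_binomialSeries_of_pow_dvd hkn hβ (rep_mul n (rep_mul n (rep_mul n (rep_C n _) hrG) hR₂) hra)
    have hsum := hasSum_coeff_of_sub_coe_mem_span hrep hz2 hz1.pow_eq_one
    have hfun : (fun i ↦ algebraMap ℚ_[p] ℂ_[p] (PowerSeries.coeff i (PowerSeries.map (algebraMap ℤ_[p] ℚ_[p])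
        (PowerSeries.C ((p : ℤ_[p]) ^ v₁) * G * Φ₂ * PowerSeries.binomialSeries ℤ_[p] β))) *
          (ψ ((1 : ℚ_[p]) ⊗ₜ[ℚ] ζ') - 1) ^ i) =
        fun i ↦ ((algebraMap ℚ_[p] ℂ_[p]).comp (algebraMap ℤ_[p] ℚ_[p]))
          (PowerSeries.coeff i (PowerSeries.C ((p : ℤ_[p]) ^ v₁) * G * Φ₂ * PowerSeries.binomialSeries ℤ_[p] β)) *
            (ψ ((1 : ℚ_[p]) ⊗ₜ[ℚ] ζ') - 1) ^ i := by
      funext i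
      rw [PowerSeries.coeff_map, RingHom.comp_apply]
    rw [hfun]
    exact hsum

end Summit.BirchSwinnertonDyer.Rank1Residual.Additive.PerrinRiouUnit

end
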